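import Summits.ABC.IUTFork.Conditional.Layer6OfSa

/-!
# L6 LAYER CERTIFICATE, part A — kernel witness of the RESIDUAL binder (PROOF-ONLY companion of `Layer6OfSa.lean`)

abc-iut cell, CERT-L6-A (abc-iut-w5-d012 gen 4). THIS FILE PROVES NOTHING NEW about print: it records IN THE TREE the kernel fact already
probed by CERT-L6-R (abc-iut-w5-d109, 05:58:10Z) and CERT-L6-R2 (abc-iut-w5-d223, ProbeLayer6OfSaR2 06:15:59Z) — the part-A residual
conjunction `Layer6ResidualA` (36 bare index Props of NODES-landed [IUTchII] claim nodes) is INHABITED by the index's own `_part`/`_holds`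
witnesses BY NAME, because every index claim Prop is a `StatementOf` conjunction of LANDED theorems (typed statements are theorems AS TYPED;
conditional statements carry their FACT-LIST hypotheses INSIDE the statement — see «FACTS CONSUMED» in `Layer6OfSa.lean`).
CONSEQUENCE for the apex `Conditional/AbcOfS`: the part-A binder `(h6a : Layer6ResidualA)` is dischargeable by name (`layer6ResidualA_inhabited`),
so `Layer6ConeA` holds outright (`layer6ConeA_holds`). WHAT THIS DOES NOT SAY: r = 36 remains L6's part-A PRINT-COVERAGE residual on the C
scoreboard (NODES status «landed» = the layer lead has not certified that the typed theorems cover the printed items); kernel-inhabited ≠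
lead-discharged; typed ≠ proved-as-printed; indexed ≠ endorsed; nothing here asserts that abc is proved or refuted or takes a side on
[IUTchIII] Cor. 3.12. [claim: Mochizuki2012, status: disputed]
-/

namespace Summit.ABC.IUTFork.Conditional

open Summit.ABC.IUTFork.DAG

universe u₁ u₂ u₃ u₄ u₅ u₆ u₇ u₈

/-- The part-A residual conjunction is kernel-inhabited: a term of the 36 index witness names (`_part` ×36, `_holds` ×0) and
nothing else. Kernel-inhabited ≠ lead-discharged (r = 36 stays the print-coverage count). [claim: Mochizuki2012, status: disputed] -/
theorem layer6ResidualA_inhabited : Layer6ResidualA.{u₁, u₂, u₃, u₄, u₅, u₆, u₇, u₈} :=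
  ⟨N_IUTchII_Cor1_10_part, N_IUTchII_Cor1_11_part,
    N_IUTchII_Cor1_12_i_part, N_IUTchII_Cor1_12_iii_part,
    N_IUTchII_Cor2_4_i_part, N_IUTchII_Cor2_4_ii_part,
    N_IUTchII_Cor2_4_iii_part, N_IUTchII_Cor2_5_i_part,
    N_IUTchII_Cor2_5_ii_part, N_IUTchII_Cor2_6_ii_part,
    N_IUTchII_Cor2_8_i_part, N_IUTchII_Cor4_10_i_part,
    N_IUTchII_Cor4_10_ii_part, N_IUTchII_Cor4_10_iii_part,
    N_IUTchII_Cor4_10_vi_part, N_IUTchII_Cor4_11_i_part,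
    N_IUTchII_Cor4_11_ii_part, N_IUTchII_Cor4_11_iii_part,
    N_IUTchII_Cor4_5_iii_part, N_IUTchII_Cor4_5_iv_part,
    N_IUTchII_Cor4_5_v_part, N_IUTchII_Prop1_2_i_part,
    N_IUTchII_Prop1_2_ii_part, N_IUTchII_Prop1_3_i_part,
    N_IUTchII_Prop1_3_iii_part, N_IUTchII_Prop1_4_part,
    N_IUTchII_Prop1_5_i_part, N_IUTchII_Prop2_1_part,
    N_IUTchII_Prop2_2_i_part, N_IUTchII_Prop2_2_ii_part,
    N_IUTchII_Prop3_1_i_part, N_IUTchII_Prop3_1_ii_part,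
    N_IUTchII_Prop3_3_i_part, N_IUTchII_Prop3_4_i_part,
    N_IUTchII_Prop3_4_ii_part, N_IUTchII_Prop4_1_iii_part⟩

/-- Hence the whole [IUTchII] slice `Layer6ConeA` holds in the kernel (discharged half by `layer6DischargedA_holds`, residual half by
`layer6ResidualA_inhabited`). Kernel-inhabited ≠ lead-discharged. [claim: Mochizuki2012, status: disputed] -/
theorem layer6ConeA_holds : Layer6ConeA.{u₁, u₂, u₃, u₄, u₅, u₆, u₇, u₈} :=
  layer6ConeA_of layer6ResidualA_inhabited

end Summit.ABC.IUTFork.Conditional
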